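/-
Copyright (c) 2026 the pub-hodgecm-mathlib formalisation cell (harness21).  Prover seat hodgecm-mathlib-K2Liu-p02 (g3), Track B «K2-LIT» ∕
hLiu418 #184♮, unit U6 «FIRST TERM AT THE TOP POLE», socket #42R `sig_K2LiuEisensteinResidueIsThetaIntegral` (steward lineage K2Liu-p02):
organ O42.3f «DET-TWIST» — Siegel sections, standard families, Eisenstein series, continuations and residues under the twist by an
automorphic character `α ∘ det` of `H(𝔸)`.  2026-09-04.
-/
import Literature.NumberTheory.GelbartRogawski1991.DoubledWeilRepresentationDetTwist   -- ★ `detH`, `ratioHecke`, `detChar`, `detH_eq_idelesRatio_of_isSiegelDelta`, `IsDoubledWeilRep.detTwist`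
import Literature.NumberTheory.K2Lit.SiegelStandardSections                          -- ★ D1′: `IwasawaDatum`, `IsStandardSectionFamily`, `rightTranslateSpan`
import Literature.NumberTheory.K2Lit.SiegelWeilSectionLine                           -- ★ O42.3a: `swSection`
import HarnessLib

/-!
# K2_Liu road (hLiu418 = stmt-HodgeConjecture-24832), unit U6 «FIRST TERM», socket #42R: organ O42.3f —
# the DETERMINANT TWIST `f ↦ (α ∘ det)·f` on Siegel sections, standard families, Eisenstein series, continuations and residues

Cell `pub/hodgecm-mathlib` (D-0151), Track B; socket #42R `sig_K2LiuEisensteinResidueIsThetaIntegral` (U6 :363; steward lineage K2Liu-p02;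
SPEC v2 `K2/K2Liu-p02/g3/SPEC-42R-v2-GlueAndGenerators.K2Liup02g3.md` §3 «T1∕T2»).

WHY.  The GENERATORS of the #42R road (SPEC v2 §3 (a)) are μ-TWISTED Siegel–Weil families: the tree's tensor datum (★ `swSectionTensor`,
p856679) produces sections in `I(s, χ_b^{M₂})` (`M₂ = 3`), and the socket wants `I(s, χ_D)`, `χ_D = toHeckeCharacter L lam⁻¹`; the two
characters have the same restriction `ε` to `𝕀_{L⁺}`, so `χ_D = χ_b³ · α̃` with `α̃(d) = α(d / d̄)` for an automorphic character `α` of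
`U(1)(𝔸_{L⁺})` (★ `ratioHecke`, [GelbartRogawski1991, §3.1 Remark p. 457]), and the passage `I(s, χ) → I(s, χ·α̃)` is multiplication by the
automorphic character `α ∘ det` of `H(𝔸)` (★ `detChar`; `det p = x(p) / x(p)‾` on `P_Δ(𝔸)`, ★ `detH_eq_idelesRatio_of_isSiegelDelta`,
[Kudla1994, §3], [HarrisKudlaSweet1996, (1.11)–(1.12)]).  The Weil-representation side of this twist is ★ `IsDoubledWeilRep.detTwist` ∕ ★
`chiSplittingLine_mul_ratioHecke`; THIS FILE is the SECTION side, i.e. everything the glue ★ `residueIsThetaLift_of_generators` (p856790)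
asks of a generator except the theta identity itself:

* §1 `chiDet_mul_char`, `chiDet_ratioHecke`, `siegelDeltaCharacter_mul_ratioHecke` — on `P_Δ(𝔸)`:
  `χ·α̃`'s inducing character is `α(det p)` times `χ`'s;
* §2 `isSiegelDeltaSection_detTwist` (`f ∈ I(s, χ) ⇒ (α∘det)·f ∈ I(s, χ·α̃)`), `isSiegelDeltaSectionFamily_detTwist`,
  `isHolomorphicSectionFamily_detTwist`, `isKFinite_mul_of_map_mul`, **`isStandardSectionFamily_detTwist`** (standard families for `(𝒦, χ)`
  twist to standard families for `(𝒦, χ·α̃)`: holomorphy and flatness are untouched, `K`-finiteness because `(α∘det)(h k) =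
  (α∘det)(h)·(α∘det)(k)`), `continuous_detTwist`;
* §3 `detChar_ratH` (`α ∘ det` is trivial on `H(L⁺)`: the determinant of a rational point is a principal idele, ★ `coe_adelicDet_toAdelic`, and
  `α` is automorphic), **`eisensteinSeriesDelta_detTwist`** (`E(h; (α∘det)·f) = α(det h)·E(h; f)` — termwise, no convergence needed),
  `eisensteinFamilyDelta_detTwist`;
* §4 `continuation_detTwist` (a pole-cleared continuation `(P, E⋆)` of `f` — socket #41's clauses (i), (iv) — twists to the continuation
  `(P, α(det h)·E⋆)` of `(α∘det)·f`), `tendsto_residue_detTwist` (the `𝓝[≠] s₀`-residue twists by `α(det h)`);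
* §5 `swSection_detTwist` — the Siegel–Weil section of the det-twisted doubled Weil representation `sD ⊗ (α∘det)` (★ `adelicMpCont.twist`, whose
  `χ·α̃`-normalisation is ★ `IsDoubledWeilRep.detTwist`) IS `(α∘det)·f_Φ` — so the twisted generators of SPEC v2 §3 (a) are literally Siegel–Weil
  sections of a `χ_D`-normalised doubled Weil representation, and ★ `isSiegelDeltaSection_swSection` ∕ ★ `isKFinite_swSection` ∕ ★
  `continuous_swSection` apply to them through either description.

Mathlib + ★ only; no `sorry`, no definition, no instance, no notation.  HONEST LABEL: HC_CM is proved only modulo the 7 printed citations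
(2 remaining named inputs: hLiu418 = stmt-HodgeConjecture-24832, h413 = stmt-HodgeConjecture-24833) until rung 0 closes; this file is a
`--supports stmt-HodgeConjecture-24832` helper of the #42R road (it retires nothing by itself).

References: [GelbartRogawski1991] §3.1 Remark p. 457 L4–13 («`s* = s ⊗ ν′`»); [Kudla1994] S. Kudla, Israel J. Math. 87 (1994) §3; [HarrisKudlaSweet1996]
§1 (1.11)–(1.17); [KudlaRallis1994] §1 (standard sections); [Tan1999] §1.
-/

set_option autoImplicit false
set_option linter.dupNamespace false
-- the doubled metaplectic carrier `Mp(𝕎^𝔻)ᶜᵒⁿᵗ` elaborates slowly (cf. ★ `SiegelWeilSectionLine`): term-mode chains, sequential elaboration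
set_option Elab.async false

noncomputable section

open NumberField MeasureTheory IsDedekindDomain Filter
open scoped Matrix Topology

namespace Summit.HodgeConjecture.HodgeConjecture.Cruxes.HLiu418.K2LiuSiegelSectionDetTwist

open Literature.NumberTheory.Automorphic Literature.NumberTheory.GaloisRepresentations
open Literature.NumberTheory.GelbartRogawski1991 Literature.NumberTheory.GelbartRogawski1991.GRConstruction
open Literature.NumberTheory.GelbartRogawski1991.GRConstruction.DoubledWeilDetTwist
open Literature.NumberTheory.Weil1964
open Literature.NumberTheory.K2Lit.SiegelDoubled

variable (L : Type) [Field L] [NumberField L] [IsCMField L]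
variable {N M n : ℕ} (e : Fin N × Fin M ≃ Fin n)
  (dV : Fin N → L) (hdV : ∀ i, IsCMField.complexConj L (dV i) = dV i) (hdV0 : ∀ i, dV i ≠ 0)
  (dW : Fin M → L) (hdW : ∀ i, IsCMField.complexConj L (dW i) = dW i) (hdW0 : ∀ i, dW i ≠ 0)
  (α : UnitaryGroup.adelicOne (Fp L) L (IsCMField.complexConj L) →* ℂˣ)

/-! ## §1 The inducing character of `χ·α̃` on `P_Δ(𝔸)` -/

/-- `chiDet` is multiplicative in the character: `(χ·ν)(det_Δ p) = χ(det_Δ p)·ν(det_Δ p)`. [cite: Tan1999, §1] -/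
theorem chiDet_mul_char (χ ν : HeckeCharacter L) (p : HA L e dV hdV dW hdW) :
    chiDet L e dV hdV dW hdW (χ * ν) p = chiDet L e dV hdV dW hdW χ p * chiDet L e dV hdV dW hdW ν p := by
  unfold chiDet
  split_ifs with hu
  · exact HeckeCharacter.mul_apply χ ν hu.unit
  · exact (mul_one 1).symm

include hdV0 hdW0 in
/-- **On `P_Δ(𝔸)`, `α̃(det_Δ p) = α(det p)`** (`det p = det_Δ p / (det_Δ p)‾`, ★ `detH_eq_idelesRatio_of_isSiegelDelta`).
[cite: Kudla1994, §3] [cite: HarrisKudlaSweet1996, §1 (1.11)–(1.12)] -/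
theorem chiDet_ratioHecke (hα : Continuous α)
    (hαrat : ∀ u : UnitaryGroup.adelicOne (Fp L) L (IsCMField.complexConj L), (u : ideleGroup L) ∈ principalIdeles L → α u = 1)
    {p : HA L e dV hdV dW hdW} (hp : IsSiegelDelta L e dV hdV dW hdW p) :
    chiDet L e dV hdV dW hdW (ratioHecke L α hα hαrat) p = α (detH L e dV hdV hdV0 dW hdW hdW0 p) := by
  have hu := isUnit_detDelta_of_isSiegelDelta L e dV hdV dW hdW p hp
  unfold chiDet
  rw [dif_pos hu, ratioHecke_apply, detH_eq_idelesRatio_of_isSiegelDelta L e dV hdV hdV0 dW hdW hdW0 p hp hu]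

include hdV0 hdW0 in
/-- **The inducing character twists by `α(det p)`**: `χ_{s}^{χ·α̃}(p) = α(det p) · χ_s^{χ}(p)` on `P_Δ(𝔸)`. [cite: Kudla1994, §3] [cite: Tan1999, §1] -/
theorem siegelDeltaCharacter_mul_ratioHecke (hα : Continuous α)
    (hαrat : ∀ u : UnitaryGroup.adelicOne (Fp L) L (IsCMField.complexConj L), (u : ideleGroup L) ∈ principalIdeles L → α u = 1)
    (χ : HeckeCharacter L) (s : ℂ) {p : HA L e dV hdV dW hdW} (hp : IsSiegelDelta L e dV hdV dW hdW p) :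
    siegelDeltaCharacter L e dV hdV dW hdW (χ * ratioHecke L α hα hαrat) s p =
      ((α (detH L e dV hdV hdV0 dW hdW hdW0 p) : ℂˣ) : ℂ) * siegelDeltaCharacter L e dV hdV dW hdW χ s p := by
  unfold siegelDeltaCharacter
  rw [chiDet_mul_char, chiDet_ratioHecke L e dV hdV hdV0 dW hdW hdW0 α hα hαrat hp, Units.val_mul]
  ring

/-! ## §2 Sections, families, standard families under the twist -/

include hdV0 hdW0 in
/-- **`f ∈ I(s, χ) ⇒ (α∘det)·f ∈ I(s, χ·α̃)`** (`det` is a homomorphism; §1). [cite: KudlaRallis1994, §1] [cite: GelbartRogawski1991, §3.1 Remark p. 457 L9–13] -/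
theorem isSiegelDeltaSection_detTwist (hα : Continuous α)
    (hαrat : ∀ u : UnitaryGroup.adelicOne (Fp L) L (IsCMField.complexConj L), (u : ideleGroup L) ∈ principalIdeles L → α u = 1)
    {χ : HeckeCharacter L} {s : ℂ} {f : HA L e dV hdV dW hdW → ℂ} (hf : IsSiegelDeltaSection L e dV hdV dW hdW χ s f) :
    IsSiegelDeltaSection L e dV hdV dW hdW (χ * ratioHecke L α hα hαrat) s
      (fun h => ((detChar L e dV hdV hdV0 dW hdW hdW0 α h : ℂˣ) : ℂ) * f h) := by
  intro p hp h
  show ((detChar L e dV hdV hdV0 dW hdW hdW0 α (p * h) : ℂˣ) : ℂ) * f (p * h) =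
    siegelDeltaCharacter L e dV hdV dW hdW (χ * ratioHecke L α hα hαrat) s p *
      (((detChar L e dV hdV hdV0 dW hdW hdW0 α h : ℂˣ) : ℂ) * f h)
  rw [siegelDeltaCharacter_mul_ratioHecke L e dV hdV hdV0 dW hdW hdW0 α hα hαrat χ s hp, hf p hp h, map_mul, Units.val_mul,
    MonoidHom.comp_apply]
  ring

include hdV0 hdW0 in
/-- family form. [cite: KudlaRallis1994, §1] -/
theorem isSiegelDeltaSectionFamily_detTwist (hα : Continuous α)
    (hαrat : ∀ u : UnitaryGroup.adelicOne (Fp L) L (IsCMField.complexConj L), (u : ideleGroup L) ∈ principalIdeles L → α u = 1)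
    {χ : HeckeCharacter L} {f : ℂ → HA L e dV hdV dW hdW → ℂ} (hf : IsSiegelDeltaSectionFamily L e dV hdV dW hdW χ f) :
    IsSiegelDeltaSectionFamily L e dV hdV dW hdW (χ * ratioHecke L α hα hαrat)
      (fun s h => ((detChar L e dV hdV hdV0 dW hdW hdW0 α h : ℂˣ) : ℂ) * f s h) :=
  fun s => isSiegelDeltaSection_detTwist L e dV hdV hdV0 dW hdW hdW0 α hα hαrat (hf s)

include hdV0 hdW0 in
/-- holomorphic-family form (the twist is constant in `s`). [cite: Tan1999, §1] -/
theorem isHolomorphicSectionFamily_detTwist (hα : Continuous α)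
    (hαrat : ∀ u : UnitaryGroup.adelicOne (Fp L) L (IsCMField.complexConj L), (u : ideleGroup L) ∈ principalIdeles L → α u = 1)
    {χ : HeckeCharacter L} {f : ℂ → HA L e dV hdV dW hdW → ℂ} (hf : IsHolomorphicSectionFamily L e dV hdV dW hdW χ f) :
    IsHolomorphicSectionFamily L e dV hdV dW hdW (χ * ratioHecke L α hα hαrat)
      (fun s h => ((detChar L e dV hdV hdV0 dW hdW hdW0 α h : ℂˣ) : ℂ) * f s h) :=
  ⟨isSiegelDeltaSectionFamily_detTwist L e dV hdV hdV0 dW hdW hdW0 α hα hαrat hf.1, fun h => (hf.2 h).const_mul _⟩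

/-- **`K`-finiteness is preserved by any multiplicative twist**: if `θ(h k) = θ(h)·θ(k)` then the right `K`-translates of `θ·φ` lie in the image
of the span of the right `K`-translates of `φ` under multiplication by `θ`. [cite: HarrisKudlaSweet1996, §1 (1.16)] [cite: Tan1999, §1] -/
theorem isKFinite_mul_of_map_mul {𝒦 : IwasawaDatum L e dV hdV dW hdW} (θ : HA L e dV hdV dW hdW →* ℂˣ) {φ : HA L e dV hdV dW hdW → ℂ}
    (hφ : Literature.NumberTheory.K2Lit.SiegelDoubled.IsKFinite 𝒦 φ) :
    Literature.NumberTheory.K2Lit.SiegelDoubled.IsKFinite 𝒦 (fun h => ((θ h : ℂˣ) : ℂ) * φ h) := by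
  -- multiplication by `θ`
  let Mθ : (HA L e dV hdV dW hdW → ℂ) →ₗ[ℂ] (HA L e dV hdV dW hdW → ℂ) :=
    { toFun := fun ψ h => ((θ h : ℂˣ) : ℂ) * ψ h
      map_add' := fun ψ ψ' => funext fun h => by simp only [Pi.add_apply, mul_add]
      map_smul' := fun c ψ => funext fun h => by simp only [Pi.smul_apply, smul_eq_mul, RingHom.id_apply]; ring }
  have hle : rightTranslateSpan 𝒦 (fun h => ((θ h : ℂˣ) : ℂ) * φ h) ≤ (rightTranslateSpan 𝒦 φ).map Mθ := by
    refine Submodule.span_le.2 ?_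
    rintro _ ⟨k, rfl⟩
    refine ⟨((θ (k : HA L e dV hdV dW hdW) : ℂˣ) : ℂ) • fun h => φ (h * (k : HA L e dV hdV dW hdW)),
      Submodule.smul_mem _ _ (rightTranslate_mem_rightTranslateSpan 𝒦 φ k.2), funext fun h => ?_⟩
    simp only [Mθ, LinearMap.coe_mk, AddHom.coe_mk, Pi.smul_apply, smul_eq_mul, map_mul, Units.val_mul]
    ring
  unfold Literature.NumberTheory.K2Lit.SiegelDoubled.IsKFinite at *
  haveI := hφ
  exact Submodule.finiteDimensional_of_le hle

include hdV0 hdW0 in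
/-- **STANDARD FAMILIES TWIST TO STANDARD FAMILIES**: `f` standard for `(𝒦, χ)` ⇒ `(α∘det)·f` standard for `(𝒦, χ·α̃)` (holomorphy and
flatness untouched, `K`-finiteness by `isKFinite_mul_of_map_mul`). [cite: KudlaRallis1994, §1] [cite: HarrisKudlaSweet1996, §1 (1.15)–(1.17)] -/
theorem isStandardSectionFamily_detTwist (hα : Continuous α)
    (hαrat : ∀ u : UnitaryGroup.adelicOne (Fp L) L (IsCMField.complexConj L), (u : ideleGroup L) ∈ principalIdeles L → α u = 1)
    {𝒦 : IwasawaDatum L e dV hdV dW hdW} {χ : HeckeCharacter L}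
    {f : ℂ → HA L e dV hdV dW hdW → ℂ} (hf : IsStandardSectionFamily 𝒦 χ f) :
    IsStandardSectionFamily 𝒦 (χ * ratioHecke L α hα hαrat)
      (fun s h => ((detChar L e dV hdV hdV0 dW hdW hdW0 α h : ℂˣ) : ℂ) * f s h) :=
  ⟨isHolomorphicSectionFamily_detTwist L e dV hdV hdV0 dW hdW hdW0 α hα hαrat hf.1,
    fun s => isKFinite_mul_of_map_mul L e dV hdV dW hdW (detChar L e dV hdV hdV0 dW hdW hdW0 α) (hf.2.1 s),
    fun k hk s s' => by simp only [hf.2.2 k hk s s']⟩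

include hdV0 hdW0 in
/-- the twist of a continuous function is continuous (★ `continuous_coe_detChar`). [cite: GelbartRogawski1991, §3.1 Remark p. 457 L9–13] -/
theorem continuous_detTwist (hα : Continuous α) {f : HA L e dV hdV dW hdW → ℂ} (hf : Continuous f) :
    Continuous fun h => ((detChar L e dV hdV hdV0 dW hdW hdW0 α h : ℂˣ) : ℂ) * f h :=
  (continuous_coe_detChar L e dV hdV hdV0 dW hdW hdW0 α hα).mul hf

/-! ## §3 `α ∘ det` is automorphic; the Eisenstein series twists by `α(det h)` -/

include hdV0 hdW0 in
/-- **`α(det γ) = 1` for `γ ∈ H(L⁺)`**: the determinant of a rational point is a principal idele (★ `coe_adelicDet_toAdelic`) and `α` is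
automorphic. [cite: GelbartRogawski1991, §3.1 Remark p. 457 L9–13] -/
theorem detChar_ratH
    (hαrat : ∀ u : UnitaryGroup.adelicOne (Fp L) L (IsCMField.complexConj L), (u : ideleGroup L) ∈ principalIdeles L → α u = 1)
    (γ : ratH L e dV hdV dW hdW) :
    detChar L e dV hdV hdV0 dW hdW hdW0 α (γ : HA L e dV hdV dW hdW) = 1 := by
  obtain ⟨g, hg⟩ := γ.2
  rw [MonoidHom.comp_apply, ← hg]
  refine hαrat _ ⟨Matrix.GeneralLinearGroup.det (g : GL (Fin (n + n)) L), ?_⟩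
  exact (UnitaryGroup.coe_adelicDet_toAdelic (Fp L) L (IsCMField.complexConj L) (n + n) (hermD L e dV hdV dW hdW)
    (det_hermD_ne_zero L e dV hdV hdV0 dW hdW hdW0) g).symm

include hdV0 hdW0 in
/-- **`E(h; (α∘det)·f) = α(det h)·E(h; f)`** for ANY `f` (termwise: `α(det(γ h)) = α(det h)` by `detChar_ratH`; `tsum_mul_left`; no convergence
hypothesis — off the domain of summability both sides are `0`). [cite: KudlaRallis1994, §1] [cite: GelbartRogawski1991, §3.1 Remark p. 457 L9–13] -/
theorem eisensteinSeriesDelta_detTwist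
    (hαrat : ∀ u : UnitaryGroup.adelicOne (Fp L) L (IsCMField.complexConj L), (u : ideleGroup L) ∈ principalIdeles L → α u = 1)
    (f : HA L e dV hdV dW hdW → ℂ) (h : HA L e dV hdV dW hdW) :
    eisensteinSeriesDelta L e dV hdV dW hdW (fun x => ((detChar L e dV hdV hdV0 dW hdW hdW0 α x : ℂˣ) : ℂ) * f x) h =
      ((detChar L e dV hdV hdV0 dW hdW hdW0 α h : ℂˣ) : ℂ) * eisensteinSeriesDelta L e dV hdV dW hdW f h := by
  unfold eisensteinSeriesDelta
  rw [← tsum_mul_left]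
  refine tsum_congr fun q => ?_
  show ((detChar L e dV hdV hdV0 dW hdW hdW0 α
      ((((Quotient.out q : ratH L e dV hdV dW hdW) : HA L e dV hdV dW hdW)) * h) : ℂˣ) : ℂ) *
        f ((((Quotient.out q : ratH L e dV hdV dW hdW) : HA L e dV hdV dW hdW)) * h) =
    ((detChar L e dV hdV hdV0 dW hdW hdW0 α h : ℂˣ) : ℂ) *
      f ((((Quotient.out q : ratH L e dV hdV dW hdW) : HA L e dV hdV dW hdW)) * h)
  rw [map_mul, detChar_ratH L e dV hdV hdV0 dW hdW hdW0 α hαrat, one_mul]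

include hdV0 hdW0 in
/-- family form: `E(h; ((α∘det)·f)_s) = α(det h)·E(h; f_s)`. [cite: KudlaRallis1994, §1] -/
theorem eisensteinFamilyDelta_detTwist
    (hαrat : ∀ u : UnitaryGroup.adelicOne (Fp L) L (IsCMField.complexConj L), (u : ideleGroup L) ∈ principalIdeles L → α u = 1)
    (f : ℂ → HA L e dV hdV dW hdW → ℂ) (s : ℂ) (h : HA L e dV hdV dW hdW) :
    eisensteinFamilyDelta L e dV hdV dW hdW (fun s x => ((detChar L e dV hdV hdV0 dW hdW hdW0 α x : ℂˣ) : ℂ) * f s x) s h =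
      ((detChar L e dV hdV hdV0 dW hdW hdW0 α h : ℂˣ) : ℂ) * eisensteinFamilyDelta L e dV hdV dW hdW f s h :=
  eisensteinSeriesDelta_detTwist L e dV hdV hdV0 dW hdW hdW0 α hαrat (f s) h

/-! ## §4 Continuations and residues under the twist -/

include hdV0 hdW0 in
/-- **Pole-cleared continuations twist**: if `(P, E⋆)` satisfies socket #41's clauses (i) (holomorphy on `{Re s > 0}` in `s`) and (iv)
(`E⋆ = ∏_{p∈P}(s−p)·E^Δ(·; f_s)` on `Re s > n/2`) for `f`, then `(P, α(det h)·E⋆)` satisfies them for `(α∘det)·f`. [cite: KudlaRallis1994, §1]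
[cite: Liu2021, Lem. B.12 pp. 103–104] -/
theorem continuation_detTwist
    (hαrat : ∀ u : UnitaryGroup.adelicOne (Fp L) L (IsCMField.complexConj L), (u : ideleGroup L) ∈ principalIdeles L → α u = 1)
    (f : ℂ → HA L e dV hdV dW hdW → ℂ) (P : Finset ℂ) (Es : ℂ → HA L e dV hdV dW hdW → ℂ)
    (hhol : ∀ h : HA L e dV hdV dW hdW, DifferentiableOn ℂ (fun s => Es s h) {s : ℂ | 0 < s.re})
    (heq : ∀ (s : ℂ) (h : HA L e dV hdV dW hdW), (n : ℝ) / 2 < s.re →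
      Es s h = (∏ p ∈ P, (s - p)) * eisensteinFamilyDelta L e dV hdV dW hdW f s h) :
    (∀ h : HA L e dV hdV dW hdW, DifferentiableOn ℂ
        (fun s => ((detChar L e dV hdV hdV0 dW hdW hdW0 α h : ℂˣ) : ℂ) * Es s h) {s : ℂ | 0 < s.re}) ∧
      ∀ (s : ℂ) (h : HA L e dV hdV dW hdW), (n : ℝ) / 2 < s.re →
        ((detChar L e dV hdV hdV0 dW hdW hdW0 α h : ℂˣ) : ℂ) * Es s h =
          (∏ p ∈ P, (s - p)) * eisensteinFamilyDelta L e dV hdV dW hdW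
            (fun s x => ((detChar L e dV hdV hdV0 dW hdW hdW0 α x : ℂˣ) : ℂ) * f s x) s h := by
  refine ⟨fun h => (hhol h).const_mul _, fun s h hs => ?_⟩
  rw [heq s h hs, eisensteinFamilyDelta_detTwist L e dV hdV hdV0 dW hdW hdW0 α hαrat f s h]
  ring

include hdV0 hdW0 in
/-- **Residues twist**: `(s − s₀)·E⋆(s,h)/∏(s−p) → R` along `𝓝[≠] s₀` ⇒ `(s − s₀)·(α(det h)E⋆(s,h))/∏(s−p) → α(det h)·R`.
[cite: Liu2021, Lem. B.12 pp. 103–104] -/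
theorem tendsto_residue_detTwist (P : Finset ℂ) (Es : ℂ → HA L e dV hdV dW hdW → ℂ) (h : HA L e dV hdV dW hdW) {s₀ R : ℂ}
    (hR : Tendsto (fun s : ℂ => (s - s₀) * (Es s h / ∏ p ∈ P, (s - p))) (𝓝[≠] s₀) (𝓝 R)) :
    Tendsto (fun s : ℂ => (s - s₀) * (((detChar L e dV hdV hdV0 dW hdW hdW0 α h : ℂˣ) : ℂ) * Es s h / ∏ p ∈ P, (s - p)))
      (𝓝[≠] s₀) (𝓝 (((detChar L e dV hdV hdV0 dW hdW hdW0 α h : ℂˣ) : ℂ) * R)) := by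
  refine (hR.const_mul ((detChar L e dV hdV hdV0 dW hdW hdW0 α h : ℂˣ) : ℂ)).congr fun s => ?_
  ring

/-! ## §5 The Siegel–Weil section of the det-twisted doubled Weil representation is the det-twist of the Siegel–Weil section -/

include hdV0 hdW0 in
/-- **`f_Φ^{sD ⊗ (α∘det)}(h) = α(det h) · f_Φ^{sD}(h)`**: the Siegel–Weil section (★ `swSection`) of the twisted representation
`sD ⊗ (α∘det)` (★ `adelicMpCont.twist`; it is `χ·α̃`-normalised when `sD` is `χ`-normalised, ★ `IsDoubledWeilRep.detTwist`) is the det-twist of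
the Siegel–Weil section of `sD` (`ω((s ⊗ η)(h))Φ = η(h)•ω(s h)Φ`, ★ `adelicMpCont.omega_twist`, and `ω(r_F(δ))` is linear).
[cite: GelbartRogawski1991, §3.1 Remark p. 457 L9–13] [cite: KudlaRallis1994, §1] -/
theorem swSection_detTwist (sD : HA L e dV hdV dW hdW →* MpD L e dV hdV dW hdW) (Φ : piSchwartzBruhat (Fp L) (Fin (n + n)))
    (h : HA L e dV hdV dW hdW) :
    swSection L e dV hdV hdV0 dW hdW hdW0
        (adelicMpCont.twist (Fp L) (Fin (n + n)) (gramDA L e dV hdV dW hdW) sD (detChar L e dV hdV hdV0 dW hdW hdW0 α)) Φ h =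
      ((detChar L e dV hdV hdV0 dW hdW hdW0 α h : ℂˣ) : ℂ) * swSection L e dV hdV hdV0 dW hdW hdW0 sD Φ h := by
  -- `ω(r_F(δ) · q)Φ = (ω(r_F(δ)) ∘ ω(q)) Φ` for the two `q`'s (the representation is multiplicative; term mode, no rewriting in `Mp`)
  have h1 := LinearMap.congr_fun
    ((adelicMpCont.omega (Fp L) (Fin (n + n)) (gramDA L e dV hdV dW hdW)).map_mul (rDelta L e dV hdV hdV0 dW hdW hdW0)
      (adelicMpCont.twist (Fp L) (Fin (n + n)) (gramDA L e dV hdV dW hdW) sD (detChar L e dV hdV hdV0 dW hdW hdW0 α) h)) Φ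
  have h3 := LinearMap.congr_fun
    ((adelicMpCont.omega (Fp L) (Fin (n + n)) (gramDA L e dV hdV dW hdW)).map_mul (rDelta L e dV hdV hdV0 dW hdW hdW0) (sD h)) Φ
  -- the twist is a scalar on `ω(sD h)Φ` (definitional, ★ `adelicMpCont.omega_twist`)
  have h2 := adelicMpCont.omega_twist (F := Fp L) (ι := Fin (n + n)) (T := gramDA L e dV hdV dW hdW) sD
    (detChar L e dV hdV hdV0 dW hdW hdW0 α) h Φ
  -- applied forms `ω(r_F(δ)·q)Φ = ω(r_F(δ)) (ω(q)Φ)` and the scalar pushed through the linear operator `ω(r_F(δ))` — all in term mode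
  have h1' := h1.trans (Module.End.mul_apply _ _ _)
  have h3' := h3.trans (Module.End.mul_apply _ _ _)
  have h4 := (congrArg (adelicMpCont.omega (Fp L) (Fin (n + n)) (gramDA L e dV hdV dW hdW) (rDelta L e dV hdV hdV0 dW hdW hdW0)) h2).trans
    ((adelicMpCont.omega (Fp L) (Fin (n + n)) (gramDA L e dV hdV dW hdW) (rDelta L e dV hdV hdV0 dW hdW hdW0)).map_smul
      ((detChar L e dV hdV hdV0 dW hdW hdW0 α h : ℂˣ) : ℂ)
      (adelicMpCont.omega (Fp L) (Fin (n + n)) (gramDA L e dV hdV dW hdW) (sD h) Φ))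
  have key := h1'.trans (h4.trans (congrArg (fun X => ((detChar L e dV hdV hdV0 dW hdW hdW0 α h : ℂˣ) : ℂ) • X) h3'.symm))
  exact congrArg (fun T : piSchwartzBruhat (Fp L) (Fin (n + n)) => (T : (Fin (n + n) → AdeleRing (𝓞 (Fp L)) (Fp L)) → ℂ) 0) key

end Summit.HodgeConjecture.HodgeConjecture.Cruxes.HLiu418.K2LiuSiegelSectionDetTwist

end
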